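import Summits.CriticalPhenomena.PercolationContinuityZ3.Theorems.PercNearOneGluingNoHeavyQuantThreePortResidualKit
import HarnessLib

/-!
# `Z(3,2)` at a three-port observer: the cell-solver interface WITH THE LINEAR THREE-CLUSTER ROWS (H_κ)

builds on p205010 (kernel theorem, internal audit signed; external expert review pending)

Support file (`--supports stmt-CriticalPhenomena-4575`), seat `prim-quant-p1` (gen 38); memo
`run/shared/lean/prim/quant/prim-quant-p1-g38/FOR-LEAD-Z32-H.md`.  No definitions, no named facts, no sorries; standard axioms.

p1 g3–g5 reduced `Z(3,2)` at a THREE-PORT observer (all positive pairs of `o` go to `a, b, c`; hairs `α, β, γ`) to real algebra in the hairs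
and the five off-`o` cells `U0, Uab, Uac, Ubc, U3` (`ThreePort.le_one_reached_le_of_cellSolver`, p219849), and found that the rows then
known (exchanges, Gladkov–Zimin, Gladkov's Lemma 1.2, the mean) leave an abstract witness (`ThreePort.lens_witness`).  This seat's memo
identifies the missing realizability input as a LINEAR three-cluster row of Gladkov type (conjectured; numerically `κ* ≈ 0.835`):

  (H_κ, apex `a`)   `Uab + Uac ≥ κ · (Uab + Uac + U3) · (U0 + Uab + Uac)`,
  i.e. `P({a↔b ∨ a↔c} ∩ {b↮c}) ≥ κ · P(a ↔ {b,c}) · P(b ↮ c)` — Harris gives the reverse with `κ = 1`;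
  equivalently `Cov(1{a attached}, 1{b↔c}) = U3·U0 − (Uab+Uac)·Ubc ≤ (1−κ)·P(a attached)·P(b↮c)`
  (Gladkov 2024, Thm. 1.3 [tree `gladkov2024_thm_1_3`] is its qualitative shadow; his Conjecture 10.1 is the nearest printed statement).

It kills the lens by a factor 13 and, numerically, the abstract three-port system has no `Z`-violator once the three H rows with `κ ≥ 0.3` are
added.  THIS FILE does the measure theory once and for all: `ThreePort.le_one_reached_le_of_cellSolverH` = the g4 interface with the three
H rows (at the apexes `a, b, c`, in the `a`-dictionary, for an arbitrary real `κ`) added both as hypotheses on the off-`o` law and as premises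
of the cell solver.  A real-algebra refutation of {cells, exchanges, GZ, H_κ, mean} for given hairs — e.g. the closed-form chain of the memo
(§6: `κ ≥ 3/5` on the collar `max hair < ½, min hair < 3/10`, the rest being `…_of_hairs_ge_threeTenths` / the heavy-hair theorem) — then
yields `Z(3,2)` at that observer for every graph satisfying H_κ off `o`.
[cite: Gladkov2024, Thm. 1.3 (p. 2), Conj. 10.1 (p. 18), arXiv:2408.08457]; [cite: GladkovZimin2024, Thm. 4.6]; [cite: KozmaNitzan2024, Lemma 2 (p. 6)] (context).
-/

noncomputable section

namespace Summit.CriticalPhenomena.PercolationContinuityZ3.Theorems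

open MeasureTheory Set Literature.Probability.LatticeModels Literature.Probability.Percolation
open scoped Classical BigOperators

variable {n : ℕ}

namespace ThreePort

/-- **`Z(3,2)` at a three-port observer from any cell solver that may use the three linear three-cluster rows H_κ** (the g4 interface
`le_one_reached_le_of_cellSolver` with the premises `κ(Uab+Uac+U3)(U0+Uab+Uac) ≤ Uab+Uac` and its two relabellings added; the rows are
hypotheses `hHa, hHb, hHc` on the off-`o` three-point law of `(a, b, c)`). [this work] -/
theorem le_one_reached_le_of_cellSolverH (κ : ℝ) (w : Sym2 (Fin n) → unitInterval) (R : Finset (Fin n)) (o a b c : Fin n) (t : ℝ)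
    (hR : R = {a, b, c}) (hao : a ≠ o) (hbo : b ≠ o) (hco : c ≠ o) (hab : a ≠ b) (hac : a ≠ c) (hbc : b ≠ c)
    (hobs : ∀ u, u ≠ o → u ≠ a → u ≠ b → u ≠ c → w s(o, u) = 0)
    (hsolve : ∀ U0 Uab Uac Ubc U3 : ℝ, 0 ≤ U0 → 0 ≤ Uab → 0 ≤ Uac → 0 ≤ Ubc → 0 ≤ U3 →
      Uab + Uac + Ubc + U3 + U0 = 1 →
      U0 * ((1 - (w s(o, a) : ℝ)) * w s(o, b) * w s(o, c) - w s(o, a) * (1 - w s(o, b)) * (1 - w s(o, c))) +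
        Ubc * (w s(o, b) + w s(o, c) - w s(o, b) * w s(o, c) - w s(o, a)) < 0 →
      U0 * ((1 - (w s(o, b) : ℝ)) * w s(o, a) * w s(o, c) - w s(o, b) * (1 - w s(o, a)) * (1 - w s(o, c))) +
        Uac * (w s(o, a) + w s(o, c) - w s(o, a) * w s(o, c) - w s(o, b)) < 0 →
      U0 * ((1 - (w s(o, c) : ℝ)) * w s(o, a) * w s(o, b) - w s(o, c) * (1 - w s(o, a)) * (1 - w s(o, b))) +
        Uab * (w s(o, a) + w s(o, b) - w s(o, a) * w s(o, b) - w s(o, c)) < 0 →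
      (U0 + Ubc) * (Uab + Uac + U3) ≤ Uab + Uac + Ubc →
      (U0 + Uac) * (Uab + Ubc + U3) ≤ Uab + Uac + Ubc →
      (U0 + Uab) * (Uac + Ubc + U3) ≤ Uab + Uac + Ubc →
      κ * (Uab + Uac + U3) * (U0 + Uab + Uac) ≤ Uab + Uac →
      κ * (Uab + Ubc + U3) * (U0 + Uab + Ubc) ≤ Uab + Ubc →
      κ * (Uac + Ubc + U3) * (U0 + Uac + Ubc) ≤ Uac + Ubc →
      2 < ((w s(o, a) : ℝ) + w s(o, b) + w s(o, c)) + (w s(o, a) + w s(o, b) - 2 * w s(o, a) * w s(o, b)) * Uab +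
        (w s(o, a) + w s(o, c) - 2 * w s(o, a) * w s(o, c)) * Uac + (w s(o, b) + w s(o, c) - 2 * w s(o, b) * w s(o, c)) * Ubc +
        ((1 - w s(o, a)) * (w s(o, b) + w s(o, c) - w s(o, b) * w s(o, c)) +
          (1 - w s(o, b)) * (w s(o, a) + w s(o, c) - w s(o, a) * w s(o, c)) +
          (1 - w s(o, c)) * (w s(o, a) + w s(o, b) - w s(o, a) * w s(o, b))) * U3 → False)
    (hHa : κ * ((prodBernoulli w).real {ω | (openGraph (ω ∩ {e | o ∉ e})).Reachable a b ∧ ¬ (openGraph (ω ∩ {e | o ∉ e})).Reachable a c} +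
        (prodBernoulli w).real {ω | (openGraph (ω ∩ {e | o ∉ e})).Reachable a c ∧ ¬ (openGraph (ω ∩ {e | o ∉ e})).Reachable a b} +
        (prodBernoulli w).real {ω | (openGraph (ω ∩ {e | o ∉ e})).Reachable a b ∧ (openGraph (ω ∩ {e | o ∉ e})).Reachable a c}) *
      ((prodBernoulli w).real {ω | ¬ (openGraph (ω ∩ {e | o ∉ e})).Reachable a b ∧ ¬ (openGraph (ω ∩ {e | o ∉ e})).Reachable a c ∧ ¬ (openGraph (ω ∩ {e | o ∉ e})).Reachable b c} +
        (prodBernoulli w).real {ω | (openGraph (ω ∩ {e | o ∉ e})).Reachable a b ∧ ¬ (openGraph (ω ∩ {e | o ∉ e})).Reachable a c} +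
        (prodBernoulli w).real {ω | (openGraph (ω ∩ {e | o ∉ e})).Reachable a c ∧ ¬ (openGraph (ω ∩ {e | o ∉ e})).Reachable a b}) ≤
      (prodBernoulli w).real {ω | (openGraph (ω ∩ {e | o ∉ e})).Reachable a b ∧ ¬ (openGraph (ω ∩ {e | o ∉ e})).Reachable a c} +
        (prodBernoulli w).real {ω | (openGraph (ω ∩ {e | o ∉ e})).Reachable a c ∧ ¬ (openGraph (ω ∩ {e | o ∉ e})).Reachable a b})
    (hHb : κ * ((prodBernoulli w).real {ω | (openGraph (ω ∩ {e | o ∉ e})).Reachable a b ∧ ¬ (openGraph (ω ∩ {e | o ∉ e})).Reachable a c} +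
        (prodBernoulli w).real {ω | (openGraph (ω ∩ {e | o ∉ e})).Reachable b c ∧ ¬ (openGraph (ω ∩ {e | o ∉ e})).Reachable a b} +
        (prodBernoulli w).real {ω | (openGraph (ω ∩ {e | o ∉ e})).Reachable a b ∧ (openGraph (ω ∩ {e | o ∉ e})).Reachable a c}) *
      ((prodBernoulli w).real {ω | ¬ (openGraph (ω ∩ {e | o ∉ e})).Reachable a b ∧ ¬ (openGraph (ω ∩ {e | o ∉ e})).Reachable a c ∧ ¬ (openGraph (ω ∩ {e | o ∉ e})).Reachable b c} +
        (prodBernoulli w).real {ω | (openGraph (ω ∩ {e | o ∉ e})).Reachable a b ∧ ¬ (openGraph (ω ∩ {e | o ∉ e})).Reachable a c} +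
        (prodBernoulli w).real {ω | (openGraph (ω ∩ {e | o ∉ e})).Reachable b c ∧ ¬ (openGraph (ω ∩ {e | o ∉ e})).Reachable a b}) ≤
      (prodBernoulli w).real {ω | (openGraph (ω ∩ {e | o ∉ e})).Reachable a b ∧ ¬ (openGraph (ω ∩ {e | o ∉ e})).Reachable a c} +
        (prodBernoulli w).real {ω | (openGraph (ω ∩ {e | o ∉ e})).Reachable b c ∧ ¬ (openGraph (ω ∩ {e | o ∉ e})).Reachable a b})
    (hHc : κ * ((prodBernoulli w).real {ω | (openGraph (ω ∩ {e | o ∉ e})).Reachable a c ∧ ¬ (openGraph (ω ∩ {e | o ∉ e})).Reachable a b} +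
        (prodBernoulli w).real {ω | (openGraph (ω ∩ {e | o ∉ e})).Reachable b c ∧ ¬ (openGraph (ω ∩ {e | o ∉ e})).Reachable a b} +
        (prodBernoulli w).real {ω | (openGraph (ω ∩ {e | o ∉ e})).Reachable a b ∧ (openGraph (ω ∩ {e | o ∉ e})).Reachable a c}) *
      ((prodBernoulli w).real {ω | ¬ (openGraph (ω ∩ {e | o ∉ e})).Reachable a b ∧ ¬ (openGraph (ω ∩ {e | o ∉ e})).Reachable a c ∧ ¬ (openGraph (ω ∩ {e | o ∉ e})).Reachable b c} +
        (prodBernoulli w).real {ω | (openGraph (ω ∩ {e | o ∉ e})).Reachable a c ∧ ¬ (openGraph (ω ∩ {e | o ∉ e})).Reachable a b} +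
        (prodBernoulli w).real {ω | (openGraph (ω ∩ {e | o ∉ e})).Reachable b c ∧ ¬ (openGraph (ω ∩ {e | o ∉ e})).Reachable a b}) ≤
      (prodBernoulli w).real {ω | (openGraph (ω ∩ {e | o ∉ e})).Reachable a c ∧ ¬ (openGraph (ω ∩ {e | o ∉ e})).Reachable a b} +
        (prodBernoulli w).real {ω | (openGraph (ω ∩ {e | o ∉ e})).Reachable b c ∧ ¬ (openGraph (ω ∩ {e | o ∉ e})).Reachable a b})
    (hsum : 2 < (prodBernoulli w).real (openConn o a) + (prodBernoulli w).real (openConn o b) +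
      (prodBernoulli w).real (openConn o c))
    (hta : (prodBernoulli w).real (openConn o a)ᶜ ≤ t) (htb : (prodBernoulli w).real (openConn o b)ᶜ ≤ t)
    (htc : (prodBernoulli w).real (openConn o c)ᶜ ≤ t) :
    (prodBernoulli w).real {ω : BondConfig (Fin n) | (R.filter fun v => ω ∈ openConn o v).card ≤ 1} ≤ t := by
  have ha : a ∈ R := (by simp [hR]); have hb : b ∈ R := (by simp [hR]); have hc : c ∈ R := by simp [hR]
  by_cases hA : (prodBernoulli w).real {ω | ω ∈ openConn o a ∧ ω ∉ openConn o b ∧ ω ∉ openConn o c} ≤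
      (prodBernoulli w).real {ω | ω ∉ openConn o a ∧ ω ∈ openConn o b ∧ ω ∈ openConn o c}
  · exact (OneCutFive.measureReal_le_one_le_compl_of_exchange w R o a b c ha hb hc hab hac hbc hA).trans hta
  by_cases hB : (prodBernoulli w).real {ω | ω ∈ openConn o b ∧ ω ∉ openConn o a ∧ ω ∉ openConn o c} ≤
      (prodBernoulli w).real {ω | ω ∉ openConn o b ∧ ω ∈ openConn o a ∧ ω ∈ openConn o c}
  · exact (OneCutFive.measureReal_le_one_le_compl_of_exchange w R o b a c hb ha hc hab.symm hbc hac hB).trans htb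
  by_cases hC : (prodBernoulli w).real {ω | ω ∈ openConn o c ∧ ω ∉ openConn o a ∧ ω ∉ openConn o b} ≤
      (prodBernoulli w).real {ω | ω ∉ openConn o c ∧ ω ∈ openConn o a ∧ ω ∈ openConn o b}
  · exact (OneCutFive.measureReal_le_one_le_compl_of_exchange w R o c a b hc ha hb hac.symm hbc.symm hab hC).trans htc
  exfalso
  push Not at hA hB hC
  have hobs' : ∀ u, u ≠ o → u ≠ b → u ≠ a → u ≠ c → w s(o, u) = 0 := fun u h1 h2 h3 h4 => hobs u h1 h3 h2 h4
  have hobs'' : ∀ u, u ≠ o → u ≠ c → u ≠ a → u ≠ b → w s(o, u) = 0 := fun u h1 h2 h3 h4 => hobs u h1 h3 h4 h2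
  have hma := margin_eq w o a b c hao hbo hco hab hac hbc hobs
  have hmb := margin_eq w o b a c hbo hao hco hab.symm hbc hac hobs'
  have hmc := margin_eq w o c a b hco hao hbo hac.symm hbc.symm hab hobs''
  have hqa := real_openConn w o a b c hao hbo hco hab hac hbc hobs
  have hqb := real_openConn_b w o a b c hao hbo hco hab hac hbc hobs
  have hqc := real_openConn_c w o a b c hao hbo hco hab hac hbc hobs
  have hcells := cells_sum_eq_one w o a b c
  have hGZa := gz_offObserver w o a b c
  have hGZb := gz_offObserver_apex_b w o a b c
  have hGZc := gz_offObserver_apex_c w o a b c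
  have s1 : {ω : BondConfig (Fin n) | ¬ (openGraph (ω ∩ {e | o ∉ e})).Reachable b a ∧
      ¬ (openGraph (ω ∩ {e | o ∉ e})).Reachable b c ∧ ¬ (openGraph (ω ∩ {e | o ∉ e})).Reachable a c} =
      {ω | ¬ (openGraph (ω ∩ {e | o ∉ e})).Reachable a b ∧
        ¬ (openGraph (ω ∩ {e | o ∉ e})).Reachable a c ∧ ¬ (openGraph (ω ∩ {e | o ∉ e})).Reachable b c} := by
    ext ω; simp only [Set.mem_setOf_eq]
    exact ⟨fun ⟨h1, h2, h3⟩ => ⟨fun h => h1 h.symm, h3, h2⟩, fun ⟨h1, h2, h3⟩ => ⟨fun h => h1 h.symm, h3, h2⟩⟩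
  have s2 : {ω : BondConfig (Fin n) | (openGraph (ω ∩ {e | o ∉ e})).Reachable a c ∧
      ¬ (openGraph (ω ∩ {e | o ∉ e})).Reachable b a} =
      {ω | (openGraph (ω ∩ {e | o ∉ e})).Reachable a c ∧ ¬ (openGraph (ω ∩ {e | o ∉ e})).Reachable a b} := by
    ext ω; simp only [Set.mem_setOf_eq]
    exact ⟨fun ⟨h1, h2⟩ => ⟨h1, fun h => h2 h.symm⟩, fun ⟨h1, h2⟩ => ⟨h1, fun h => h2 h.symm⟩⟩
  have s3 : {ω : BondConfig (Fin n) | ¬ (openGraph (ω ∩ {e | o ∉ e})).Reachable c a ∧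
      ¬ (openGraph (ω ∩ {e | o ∉ e})).Reachable c b ∧ ¬ (openGraph (ω ∩ {e | o ∉ e})).Reachable a b} =
      {ω | ¬ (openGraph (ω ∩ {e | o ∉ e})).Reachable a b ∧
        ¬ (openGraph (ω ∩ {e | o ∉ e})).Reachable a c ∧ ¬ (openGraph (ω ∩ {e | o ∉ e})).Reachable b c} := by
    ext ω; simp only [Set.mem_setOf_eq]
    exact ⟨fun ⟨h1, h2, h3⟩ => ⟨h3, fun h => h1 h.symm, fun h => h2 h.symm⟩,
      fun ⟨h1, h2, h3⟩ => ⟨fun h => h2 h.symm, fun h => h3 h.symm, h1⟩⟩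
  have s4 : {ω : BondConfig (Fin n) | (openGraph (ω ∩ {e | o ∉ e})).Reachable a b ∧
      ¬ (openGraph (ω ∩ {e | o ∉ e})).Reachable c a} =
      {ω | (openGraph (ω ∩ {e | o ∉ e})).Reachable a b ∧ ¬ (openGraph (ω ∩ {e | o ∉ e})).Reachable a c} := by
    ext ω; simp only [Set.mem_setOf_eq]
    exact ⟨fun ⟨h1, h2⟩ => ⟨h1, fun h => h2 h.symm⟩, fun ⟨h1, h2⟩ => ⟨h1, fun h => h2 h.symm⟩⟩
  rw [s1, s2] at hmb
  rw [s3, s4] at hmc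
  rw [hqa, hqb, hqc, sigma_cells_collect] at hsum
  exact hsolve _ _ _ _ _ measureReal_nonneg measureReal_nonneg measureReal_nonneg measureReal_nonneg measureReal_nonneg
    hcells (by linarith [hma, hA]) (by linarith [hmb, hB]) (by linarith [hmc, hC]) hGZa hGZb hGZc hHa hHb hHc hsum

end ThreePort

end Summit.CriticalPhenomena.PercolationContinuityZ3.Theorems

end
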